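import Summits.BirchSwinnertonDyer.BirchSwinnertonDyer.Theorems.ResidualThetaTransportAtTwoSignedMuVanishingAtTwoPlusSel2
import Literature.NumberTheory.EllipticCurves.Kobayashi2003.SignedSelmerGeneratorChangeProofs
import Literature.NumberTheory.EllipticCurves.Kobayashi2003.SignedSelmerDualExistsProofs
import Literature.NumberTheory.EllipticCurves.Kobayashi2003.SignedSelmerModuleFiniteProofs
import Literature.NumberTheory.EllipticCurves.CyclotomicZpExtension
import HarnessLib

/-!
# Route `ResidualThetaTransportAtTwo`, crux Kμ⁺ `SignedMuVanishingAtTwoPlus` (stmt-BirchSwinnertonDyer-20689):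
# the algebraic half as ONE FINITENESS STATEMENT PER CURVE — conj.1 ⟺ «`Sel⁺(W/ℚ_∞)[2]` is finite» for the
# tree's canonical cyclotomic `ℤ₂`-extension `κ_cyc`, with NO `γ`, NO dual datum, NO finite-generation proviso

Cell `bsd-wall`, width seat `bsd-wall-rtt-p4-w2` on the lead line `birth` (v4). THEOREMS ONLY (no `def`, no named
fact, no `sorry`); helper `--supports` the crux; nothing about any curve is asserted and BSD is not proved by this.
Sequel of this seat's p580570 `…Sel2` (conj.1 ⟺ SEL2 with `(κ, γ)` binders and an `∃`-f.g. guard), made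
binder-free by three tree theorems: `Kobayashi2003.SignedSelmerDualData.moduleFinite` (every datum at a
top-generator pair is finitely generated), `Kobayashi2003.nonempty_signedSelmerDualData` (a datum exists), and
`Kobayashi2003.exists_addEquiv_signedSelmerInfty_of_isCyclotomic` (the signed Selmer GROUPS of two cyclotomic `κ`
are isomorphic by restriction along the equal kernels — Greenberg LNM 1716 §1 / Washington §13.1).

* `sel2Finite_iff_of_isCyclotomic` — for cyclotomic `κ₁, κ₂`: `Sel^ε(W,κ₁)[p]` finite ⟺ `Sel^ε(W,κ₂)[p]` finite.
* `muAlgebraic_iff_sel2Finite_forall_isCyclotomic` — conj.1 of Kμ⁺ ⟺ «for every habitat⁺ `W` and every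
  cyclotomic `κ`: `{s ∈ Sel⁺(W,κ) | 2s = 0}` is finite» (no `γ`, no datum, no f.g. guard).
* **`muAlgebraic_iff_sel2Finite_zpExtension`** — conj.1 ⟺ «for every habitat⁺ `W`:
  `{s ∈ Sel⁺(W, κ_cyc) | 2s = 0}` is finite», `κ_cyc = CyclotomicZp.zpExtension 2` the tree's normalised
  cyclotomic `ℤ₂`-extension — ONE concrete abelian group per curve.
* `signedMuVanishingAtTwoPlus_iff_sel2Finite_zpExtension_and_padicValRat_add_mu_eq_zero` — hence
  **Kμ⁺ ⟺ «`Sel⁺(W/ℚ_∞^{cyc})[2]` finite for every habitat⁺ `W`» ∧ «`v₂(ϖ) + μ(L♭_f) = 0` for every habitat⁺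
  `(W, f, ϖ, L♯, L♭)`»** — the crux as two elementary-looking per-curve statements, kernel-exactly.

References: S. Kobayashi, Invent. Math. 152 (2003) Def. 1.1, Thm. 1.2 [Kobayashi2003]; R. Greenberg, LNM 1716
(1999) §1 p. 60 [Greenberg1999LNM]; L. Washington, GTM 83 §13.1 [Washington1997]; R. Greenberg, V. Vatsal, Invent.
Math. 142 (2000) p. 2–3 [GreenbergVatsal2000].
-/

set_option autoImplicit false
set_option linter.dupNamespace false

noncomputable section

open scoped Classical MatrixGroups ModularForm

open CongruenceSubgroup WeierstrassCurve Literature.NumberTheory.EllipticCurves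
  Literature.NumberTheory.EllipticCurves.ModularForms Literature.NumberTheory.EllipticCurves.IwasawaAlgebra
  Literature.NumberTheory.EllipticCurves.Rank1Residual Literature.NumberTheory.EllipticCurves.Kobayashi2003
  Summit.BirchSwinnertonDyer.Rank1Residual.Supersingular Summit.BirchSwinnertonDyer.Rank1Residual.X1
  Summit.BirchSwinnertonDyer.BirchSwinnertonDyer.Theses.ResidualThetaTransportAtTwo

namespace Summit.BirchSwinnertonDyer.BirchSwinnertonDyer.Theorems.SignedMuAtTwo

universe u

/-! ## §1. `Sel^ε[p]` finite does not depend on the cyclotomic `κ` -/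

/-- Finiteness of the `p`-torsion is transported along an additive isomorphism. [folklore] -/
theorem pTorsion_finite_of_addEquiv {S₁ S₂ : Type*} [AddCommGroup S₁] [AddCommGroup S₂] (Ψ : S₂ ≃+ S₁) (p : ℕ)
    (h : {s : S₁ | p • s = 0}.Finite) : {s : S₂ | p • s = 0}.Finite := by
  refine (h.preimage Ψ.injective.injOn).subset fun s hs ↦ ?_
  simp only [Set.mem_preimage, Set.mem_setOf_eq] at hs ⊢
  rw [← map_nsmul, hs, map_zero]

/-- **`Sel^ε(E/K_∞)[p]` finite does not depend on the cyclotomic datum `κ`**: for cyclotomic `κ₁, κ₂` the signed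
Selmer groups are isomorphic (`exists_addEquiv_signedSelmerInfty_of_isCyclotomic`).
[cite: Greenberg1999LNM, §1 (p. 60)] [cite: Washington1997, §13.1] -/
theorem sel2Finite_iff_of_isCyclotomic {K : Type u} [Field K] [NumberField K] (W : WeierstrassCurve K) {p : ℕ}
    [Fact p.Prime] {κ₁ κ₂ : ZpExtension K p} (h₁ : κ₁.IsCyclotomic) (h₂ : κ₂.IsCyclotomic) (ε : ℤˣ) :
    {s : signedSelmerInfty W κ₁ ε | p • s = 0}.Finite ↔ {s : signedSelmerInfty W κ₂ ε | p • s = 0}.Finite := by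
  obtain ⟨Ψ⟩ := exists_addEquiv_signedSelmerInfty_of_isCyclotomic W h₁ h₂ ε
  exact ⟨pTorsion_finite_of_addEquiv Ψ p, pTorsion_finite_of_addEquiv Ψ.symm p⟩

/-! ## §2. conj.1 ⟺ SEL2, binder-free -/

/-- **conj.1 of Kμ⁺ ⟺ SEL2 for every cyclotomic `κ`** — no `γ`, no dual datum, no finite-generation guard
(a top generator exists by surjectivity of `κ`, a datum by `nonempty_signedSelmerDualData`, and it is finitely
generated by `moduleFinite`). [cite: Greenberg1999LNM, §1 (p. 60)] [cite: Kobayashi2003, Def. 1.1 and Thm. 1.2] -/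
theorem muAlgebraic_iff_sel2Finite_forall_isCyclotomic :
    (∀ (W : WeierstrassCurve ℚ) [W.IsElliptic] [W.IsGloballyMinimal], ¬ W.HasCM → W.analyticRank = 0 →
      GoodSS W 2 → W.frobeniusTrace 2 = 0 → W.Δ < 0 →
      ∀ (κ : ZpExtension ℚ 2) (γ : Field.absoluteGaloisGroup ℚ), κ.IsCyclotomic → κ.IsTopGenerator γ →
      ∀ (D : SignedSelmerDualData W κ γ 1) [Module.Finite (IwasawaAlgebra 2) D.X],
        Module.IsTorsion (IwasawaAlgebra 2) D.X ∧ D.mu = 0) ↔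
    (∀ (W : WeierstrassCurve ℚ) [W.IsElliptic] [W.IsGloballyMinimal], ¬ W.HasCM → W.analyticRank = 0 →
      GoodSS W 2 → W.frobeniusTrace 2 = 0 → W.Δ < 0 →
      ∀ (κ : ZpExtension ℚ 2), κ.IsCyclotomic → {s : signedSelmerInfty W κ 1 | 2 • s = 0}.Finite) := by
  constructor
  · intro h W _ _ hCM hr hss ha hΔ κ hκ
    obtain ⟨γ, hγ⟩ := κ.surjective (Multiplicative.ofAdd 1)
    have hγ' : κ.IsTopGenerator γ := hγ
    obtain ⟨D⟩ := nonempty_signedSelmerDualData W κ 1 hγ'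
    haveI : Module.Finite (IwasawaAlgebra 2) D.X := D.moduleFinite hγ'
    exact (isTorsion_and_mu_eq_zero_iff_finite_selmer_pTorsion D).mp (h W hCM hr hss ha hΔ κ γ hκ hγ' D)
  · intro h W _ _ hCM hr hss ha hΔ κ γ hκ hγ D _
    exact (isTorsion_and_mu_eq_zero_iff_finite_selmer_pTorsion D).mpr (h W hCM hr hss ha hΔ κ hκ)

/-- **conj.1 of Kμ⁺ ⟺ «`Sel⁺(W/ℚ_∞^{cyc})[2]` is finite for every habitat⁺ curve»** — ONE abelian group per curve,
for the tree's normalised cyclotomic `ℤ₂`-extension `κ_cyc = CyclotomicZp.zpExtension 2`.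
[cite: Greenberg1999LNM, §1 (p. 60)] [cite: Washington1997, §13.1] [cite: Kobayashi2003, Def. 1.1] -/
theorem muAlgebraic_iff_sel2Finite_zpExtension :
    (∀ (W : WeierstrassCurve ℚ) [W.IsElliptic] [W.IsGloballyMinimal], ¬ W.HasCM → W.analyticRank = 0 →
      GoodSS W 2 → W.frobeniusTrace 2 = 0 → W.Δ < 0 →
      ∀ (κ : ZpExtension ℚ 2) (γ : Field.absoluteGaloisGroup ℚ), κ.IsCyclotomic → κ.IsTopGenerator γ →
      ∀ (D : SignedSelmerDualData W κ γ 1) [Module.Finite (IwasawaAlgebra 2) D.X],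
        Module.IsTorsion (IwasawaAlgebra 2) D.X ∧ D.mu = 0) ↔
    (∀ (W : WeierstrassCurve ℚ) [W.IsElliptic] [W.IsGloballyMinimal], ¬ W.HasCM → W.analyticRank = 0 →
      GoodSS W 2 → W.frobeniusTrace 2 = 0 → W.Δ < 0 →
      {s : signedSelmerInfty W (CyclotomicZp.zpExtension 2) 1 | 2 • s = 0}.Finite) := by
  rw [muAlgebraic_iff_sel2Finite_forall_isCyclotomic]
  constructor
  · intro h W _ _ hCM hr hss ha hΔ
    exact h W hCM hr hss ha hΔ _ (CyclotomicZp.isCyclotomic_zpExtension 2)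
  · intro h W _ _ hCM hr hss ha hΔ κ hκ
    exact (sel2Finite_iff_of_isCyclotomic W hκ (CyclotomicZp.isCyclotomic_zpExtension 2) 1).mpr
      (h W hCM hr hss ha hΔ)

/-! ## §3. The crux as two per-curve statements -/

/-- **Kμ⁺ ⟺ «`Sel⁺(W/ℚ_∞^{cyc})[2]` finite for every habitat⁺ `W`» ∧ «`v₂(ϖ) + μ(L♭_f) = 0` for every habitat⁺
`(W, f, ϖ, L♯, L♭)`»** (kernel-exact; no print fact; this seat's p580570 / p579652 made binder-free).
[cite: Greenberg1999LNM, §1 (p. 60)] [cite: GreenbergVatsal2000, p. 2–3] [cite: Pollack2003, Prop. 6.18] -/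
theorem signedMuVanishingAtTwoPlus_iff_sel2Finite_zpExtension_and_padicValRat_add_mu_eq_zero :
    SignedMuVanishingAtTwoPlus ↔
      (∀ (W : WeierstrassCurve ℚ) [W.IsElliptic] [W.IsGloballyMinimal], ¬ W.HasCM → W.analyticRank = 0 →
        GoodSS W 2 → W.frobeniusTrace 2 = 0 → W.Δ < 0 →
        {s : signedSelmerInfty W (CyclotomicZp.zpExtension 2) 1 | 2 • s = 0}.Finite) ∧
      (∀ (W : WeierstrassCurve ℚ) [W.IsElliptic] [W.IsGloballyMinimal], ¬ W.HasCM →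
        W.analyticRank = 0 → GoodSS W 2 → W.frobeniusTrace 2 = 0 → W.Δ < 0 →
        ∀ [NeZero (W.conductorNorm ℤ)] (f : CuspForm (Gamma0 (W.conductorNorm ℤ)) 2), IsNewformOf W f →
        ∀ (ϖ : ℚ), (ϖ : ℝ) * W.realPeriodRat = plusPeriod f →
        ∀ (Lplus Lminus : IwasawaAlgebra 2), IsPollackPair f 2 Lplus Lminus →
        padicValRat 2 ϖ + MuLambda.mu Lminus = 0) := by
  rw [← muAlgebraic_iff_sel2Finite_zpExtension, muAlgebraic_iff_sel2Finite]
  exact signedMuVanishingAtTwoPlus_iff_sel2Finite_and_padicValRat_add_mu_eq_zero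

end Summit.BirchSwinnertonDyer.BirchSwinnertonDyer.Theorems.SignedMuAtTwo

end
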